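import Mathlib
import HarnessLib
import Literature.Analysis.FluidPDE.VectorCalculus
import Literature.Analysis.FluidPDE.TaoEnstrophyLocalisation
import Literature.Analysis.FluidPDE.NewtonKernel
import Literature.Analysis.FluidPDE.NewtonNearDerivatives
import Literature.Analysis.FluidPDE.SverakLandauRegularize
import Literature.Analysis.FluidPDE.VorticityStretching

/-!
# Route `ThreadingFlux`, support `ConeStructure` (stmt-NavierStokesRegularity-1221) — helper I:
# homogeneity bookkeeping and the EXPLICIT sphere-curl potential `χ = −⟨x, U(x)⟩`

Support item `ConeStructure` (card T1 of route ThreadingFlux): for `U` smooth on `ℝ³ ∖ {0}` and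
`(−1)`-homogeneous (`U(cx) = c⁻¹U(x)`, `c > 0`), `ω = curl U` is `(−2)`-homogeneous, (i) the radial part
of `ω` has zero mean on the unit ball and (ii) the tangential part of `ω` is a sphere-curl. This file:

* `curl_homogeneousExtension_smul`, `exists_norm_curl_le` — `ω(cx) = c⁻² ω(x)` and `‖ω(x)‖ ≤ M‖x‖⁻²`
  (the tree's `fderiv_homogeneous` / `exists_norm_le_mul_rpow_of_homogeneous`, applied to the extension
  of `U` by `0` at the origin, which is homogeneous at EVERY point and agrees with `U` off the origin);
* **part (ii), `exists_sphereCurl_potential`, with an explicit potential.** The planner asked for Hodge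
  theory on `S²` (`div_{S²} Ψ_tan = 0`, `H¹(S²) = 0`); none is needed: for a `(−1)`-homogeneous field,
  `x × curl U = (DU)ᵀx − DU·x` (the identity `a × curl U = ∇(a·U) − (a·∇)U` at fixed `a = x`) and
  Euler's relation `DU·x = −U` give `x × curl U = (DU)ᵀx + U = ∇⟨x, U⟩`, whence
  `‖x‖²ω − ⟨x,ω⟩x = −x × (x × ω) = x × ∇χ` with **`χ(x) = −⟨x, U(x)⟩`**, which is `C^∞` off the origin
  and `0`-homogeneous. (Consequence recorded by the planner: `⟨ω, ∇χ⟩ = 0`, vortex lines lie on the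
  cones `{χ = c}`.)

Part (i) (the zero radial mean) is in the sequel file. No new definitions, no named facts; a
vector-calculus lemma about homogeneous fields, nothing here bears on Navier–Stokes regularity.

## References

* A. J. Majda, A. L. Bertozzi, *Vorticity and Incompressible Flow* (CUP 2002), §1.1 (vector
  identities), §2.3 (homogeneous kernels). [MajdaBertozziCUP2002]
-/

noncomputable section

-- the summit and its single sub-problem share the name (CONVENTIONS §1), as in every Theorems file
set_option linter.dupNamespace false

namespace Summit.NavierStokesRegularity.NavierStokesRegularity.Theorems.ConeStructure

open Set Function Filter Topology Metric
open scoped ContDiff RealInnerProductSpace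
open Literature.Analysis.FluidPDE

variable {U : EuclideanSpace ℝ (Fin 3) → EuclideanSpace ℝ (Fin 3)}

/-! ### The extension by zero at the origin -/

/-- The extension of `U` by `0` at the origin agrees with `U` off the origin. [folklore] -/
theorem update_eq_self {x : EuclideanSpace ℝ (Fin 3)} (hx : x ≠ 0) : Function.update U 0 0 x = U x :=
  Function.update_of_ne hx _ _

/-- Off the origin the extension agrees with `U` near every point. [folklore] -/
theorem update_eventuallyEq {x : EuclideanSpace ℝ (Fin 3)} (hx : x ≠ 0) :
    Function.update U 0 0 =ᶠ[𝓝 x] U := by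
  filter_upwards [isOpen_compl_singleton.mem_nhds hx] with y hy
  exact Function.update_of_ne hy _ _

/-- Hence the same derivative off the origin. [folklore] -/
theorem fderiv_update_eq {x : EuclideanSpace ℝ (Fin 3)} (hx : x ≠ 0) :
    fderiv ℝ (Function.update U 0 0) x = fderiv ℝ U x :=
  (update_eventuallyEq hx).fderiv_eq

/-- Hence the same curl off the origin. [folklore] -/
theorem curl_update_eq {x : EuclideanSpace ℝ (Fin 3)} (hx : x ≠ 0) :
    curl (Function.update U 0 0) x = curl U x := by
  rw [curl_eq_curlCLM, curl_eq_curlCLM, fderiv_update_eq hx]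

/-- The extension is smooth off the origin if `U` is. [folklore] -/
theorem contDiffOn_update (hU : ContDiffOn ℝ ∞ U {0}ᶜ) :
    ContDiffOn ℝ ∞ (Function.update U 0 0) {0}ᶜ :=
  hU.congr fun _ hx => Function.update_of_ne hx _ _

/-- A `(−1)`-homogeneous field off the origin becomes `(−1)`-homogeneous EVERYWHERE after extension
by `0` at the origin (in the tree's `c ^ (m : ℤ)` form). [folklore] -/
theorem update_smul (hhom : ∀ x : EuclideanSpace ℝ (Fin 3), x ≠ 0 → ∀ c : ℝ, 0 < c → U (c • x) = c⁻¹ • U x)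
    (c : ℝ) (hc : 0 < c) (z : EuclideanSpace ℝ (Fin 3)) :
    Function.update U 0 0 (c • z) = c ^ (-1 : ℤ) • Function.update U 0 0 z := by
  by_cases hz : z = 0
  · subst hz; simp
  · rw [Function.update_of_ne (smul_ne_zero hc.ne' hz), Function.update_of_ne hz, hhom z hz c hc,
      zpow_neg, zpow_one]

/-! ### Homogeneity and size of the curl -/

/-- **The curl of a `(−1)`-homogeneous field is `(−2)`-homogeneous** (for the extension by zero,
at every point: derivatives of homogeneous functions are homogeneous, `fderiv_homogeneous`).
[cite: MajdaBertozziCUP2002, §2.3] -/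
theorem curl_update_smul
    (hhom : ∀ x : EuclideanSpace ℝ (Fin 3), x ≠ 0 → ∀ c : ℝ, 0 < c → U (c • x) = c⁻¹ • U x)
    (c : ℝ) (hc : 0 < c) (z : EuclideanSpace ℝ (Fin 3)) :
    curl (Function.update U 0 0) (c • z) = c ^ (-2 : ℤ) • curl (Function.update U 0 0) z := by
  have h := fderiv_homogeneous (Function.update U 0 0) (-1) (update_smul hhom) c hc z
  rw [curl_eq_curlCLM, curl_eq_curlCLM, h, map_smul]
  norm_num

/-- The curl of a field smooth off the origin is continuous off the origin. [folklore] -/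
theorem continuousOn_curl_update (hU : ContDiffOn ℝ ∞ U {0}ᶜ) :
    ContinuousOn (curl (Function.update U 0 0)) {0}ᶜ := by
  rw [curl_eq_curlCLM_comp]
  exact curlCLM.continuous.comp_continuousOn
    ((contDiffOn_update hU).continuousOn_fderiv_of_isOpen isOpen_compl_singleton (by simp))

/-- **`‖curl U(x)‖ ≤ M ‖x‖⁻²` off the origin** for `U` smooth and `(−1)`-homogeneous off the origin
(`M ≥ 0` a bound of `curl U` on the unit sphere). [cite: MajdaBertozziCUP2002, §2.3] -/
theorem exists_norm_curl_le (hU : ContDiffOn ℝ ∞ U {0}ᶜ)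
    (hhom : ∀ x : EuclideanSpace ℝ (Fin 3), x ≠ 0 → ∀ c : ℝ, 0 < c → U (c • x) = c⁻¹ • U x) :
    ∃ M : ℝ, 0 ≤ M ∧ ∀ x : EuclideanSpace ℝ (Fin 3), x ≠ 0 → ‖curl U x‖ ≤ M * ‖x‖ ^ (-(2 : ℝ)) := by
  obtain ⟨M, hM0, hM⟩ := exists_norm_le_mul_rpow_of_homogeneous (curl (Function.update U 0 0)) (-2)
    (curl_update_smul hhom) (continuousOn_curl_update hU)
  refine ⟨M, hM0, fun x hx => ?_⟩
  have h := hM x hx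
  rw [curl_update_eq hx] at h
  exact_mod_cast h

/-! ### Part (ii): the explicit sphere-curl potential -/

/-- Differentiability of `U` off the origin. [folklore] -/
theorem differentiableAt_of_ne (hU : ContDiffOn ℝ ∞ U {0}ᶜ) {x : EuclideanSpace ℝ (Fin 3)}
    (hx : x ≠ 0) : DifferentiableAt ℝ U x :=
  (hU.differentiableOn (by simp) x hx).differentiableAt (isOpen_compl_singleton.mem_nhds hx)

/-- **Euler's relation** `DU(x)·x = −U(x)` off the origin for a `(−1)`-homogeneous field.
[cite: MajdaBertozziCUP2002, §2.3] -/
theorem fderiv_apply_self (hU : ContDiffOn ℝ ∞ U {0}ᶜ)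
    (hhom : ∀ x : EuclideanSpace ℝ (Fin 3), x ≠ 0 → ∀ c : ℝ, 0 < c → U (c • x) = c⁻¹ • U x)
    {x : EuclideanSpace ℝ (Fin 3)} (hx : x ≠ 0) : fderiv ℝ U x x = -U x :=
  Sverak2011.fderiv_apply_self_of_neg_one_homogeneous
    (fun t ht => by rw [hhom x hx t ht, smul_smul, mul_inv_cancel₀ ht.ne', one_smul])
    (differentiableAt_of_ne hU hx)

/-- Euler's relation in coordinates: `∑ⱼ xⱼ ∂ⱼUᵢ(x) = −Uᵢ(x)`. [cite: MajdaBertozziCUP2002, §2.3] -/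
theorem sum_mul_partial_eq_neg (hU : ContDiffOn ℝ ∞ U {0}ᶜ)
    (hhom : ∀ x : EuclideanSpace ℝ (Fin 3), x ≠ 0 → ∀ c : ℝ, 0 < c → U (c • x) = c⁻¹ • U x)
    {x : EuclideanSpace ℝ (Fin 3)} (hx : x ≠ 0) (i : Fin 3) :
    ∑ j, x j * fderiv ℝ U x (EuclideanSpace.single j 1) i = -(U x i) := by
  have h := fderiv_apply_self hU hhom hx
  have h' := congrArg (fun w : EuclideanSpace ℝ (Fin 3) => w i) h
  simp only [PiLp.neg_apply] at h'
  rw [← h', clm_apply_coord (fderiv ℝ U x) x i]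

/-- The derivative of `χ = −⟨x, U(x)⟩` along `eᵢ`: `∂ᵢχ(x) = −(Uᵢ(x) + ⟨x, ∂ᵢU(x)⟩)`. [folklore] -/
theorem fderiv_chi_apply (hU : ContDiffOn ℝ ∞ U {0}ᶜ) {x : EuclideanSpace ℝ (Fin 3)} (hx : x ≠ 0)
    (i : Fin 3) :
    fderiv ℝ (fun y : EuclideanSpace ℝ (Fin 3) => -⟪y, U y⟫) x (EuclideanSpace.single i 1) =
      -(U x i + ⟪x, fderiv ℝ U x (EuclideanSpace.single i 1)⟫) := by
  have hd : HasFDerivAt (fun y : EuclideanSpace ℝ (Fin 3) => ⟪y, U y⟫)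
      ((fderivInnerCLM ℝ (x, U x)).comp
        ((ContinuousLinearMap.id ℝ _).prod (fderiv ℝ U x))) x :=
    (ContinuousLinearMap.id ℝ _).hasFDerivAt.inner ℝ (differentiableAt_of_ne hU hx).hasFDerivAt
  have hd' : HasFDerivAt (fun y : EuclideanSpace ℝ (Fin 3) => -⟪y, U y⟫)
      (-((fderivInnerCLM ℝ (x, U x)).comp
        ((ContinuousLinearMap.id ℝ _).prod (fderiv ℝ U x)))) x := hd.neg
  rw [hd'.fderiv]
  simp [fderivInnerCLM_apply, EuclideanSpace.inner_single_left, add_comm]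

/-- `χ = −⟨x, U(x)⟩` is `C¹` (indeed smooth) off the origin. [folklore] -/
theorem contDiffOn_chi (hU : ContDiffOn ℝ ∞ U {0}ᶜ) :
    ContDiffOn ℝ 1 (fun y : EuclideanSpace ℝ (Fin 3) => -⟪y, U y⟫) {0}ᶜ :=
  (contDiffOn_id.inner ℝ (hU.of_le (by norm_cast))).neg

/-- `χ = −⟨x, U(x)⟩` is `0`-homogeneous. [folklore] -/
theorem chi_smul (hhom : ∀ x : EuclideanSpace ℝ (Fin 3), x ≠ 0 → ∀ c : ℝ, 0 < c → U (c • x) = c⁻¹ • U x)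
    {x : EuclideanSpace ℝ (Fin 3)} (hx : x ≠ 0) {c : ℝ} (hc : 0 < c) :
    -⟪c • x, U (c • x)⟫ = -⟪x, U x⟫ := by
  rw [hhom x hx c hc, real_inner_smul_left, real_inner_smul_right, ← mul_assoc,
    mul_inv_cancel₀ hc.ne', one_mul]

/-- Coordinates of `⟨x, v⟩` in `ℝ³`. [folklore] -/
theorem inner_eq_three (x v : EuclideanSpace ℝ (Fin 3)) :
    ⟪x, v⟫ = x 0 * v 0 + x 1 * v 1 + x 2 * v 2 := by
  rw [← (EuclideanSpace.basisFun (Fin 3) ℝ).sum_repr x]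
  simp [Fin.sum_univ_three, inner_add_left, real_inner_smul_left, EuclideanSpace.inner_single_left]

/-- **The tangential vorticity is an explicit sphere-curl** (polynomial identity): for `U` smooth and
`(−1)`-homogeneous off the origin, `x × ∇χ(x) = ‖x‖² curl U(x) − ⟨x, curl U(x)⟩ x` with
`χ = −⟨x, U(x)⟩`, at every `x ≠ 0` (`x × curl U = (DU)ᵀx − DU·x`, Euler `DU·x = −U`,
`x × (x × ω) = ⟨x,ω⟩x − ‖x‖²ω`). [cite: MajdaBertozziCUP2002, §1.1 (vector identities)] -/
theorem cross_gradient_chi (hU : ContDiffOn ℝ ∞ U {0}ᶜ)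
    (hhom : ∀ x : EuclideanSpace ℝ (Fin 3), x ≠ 0 → ∀ c : ℝ, 0 < c → U (c • x) = c⁻¹ • U x)
    {x : EuclideanSpace ℝ (Fin 3)} (hx : x ≠ 0) :
    cross x (gradient (fun y : EuclideanSpace ℝ (Fin 3) => -⟪y, U y⟫) x) =
      (‖x‖ ^ 2) • curl U x - ⟪x, curl U x⟫ • x := by
  -- coordinates of the gradient
  have hg : ∀ i : Fin 3, gradient (fun y : EuclideanSpace ℝ (Fin 3) => -⟪y, U y⟫) x i =
      -(U x i + ⟪x, fderiv ℝ U x (EuclideanSpace.single i 1)⟫) := by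
    intro i
    have h1 : gradient (fun y : EuclideanSpace ℝ (Fin 3) => -⟪y, U y⟫) x i =
        ⟪gradient (fun y : EuclideanSpace ℝ (Fin 3) => -⟪y, U y⟫) x, EuclideanSpace.single i (1:ℝ)⟫ := by
      rw [EuclideanSpace.inner_single_right]; simp
    rw [h1, gradient, InnerProductSpace.toDual_symm_apply, fderiv_chi_apply hU hx]
  -- Euler relations
  have e0 := sum_mul_partial_eq_neg hU hhom hx 0
  have e1 := sum_mul_partial_eq_neg hU hhom hx 1
  have e2 := sum_mul_partial_eq_neg hU hhom hx 2
  simp only [Fin.sum_univ_three] at e0 e1 e2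
  -- abbreviations for the partials `D j i = ∂ⱼUᵢ`
  set D : Fin 3 → Fin 3 → ℝ := fun j i => fderiv ℝ U x (EuclideanSpace.single j 1) i with hD
  have hcurl : curl U x = WithLp.toLp 2 ![D 1 2 - D 2 1, D 2 0 - D 0 2, D 0 1 - D 1 0] := rfl
  have hn : ‖x‖ ^ 2 = x 0 * x 0 + x 1 * x 1 + x 2 * x 2 := by
    rw [← real_inner_self_eq_norm_sq, inner_eq_three]
  have hinner : ∀ i, ⟪x, fderiv ℝ U x (EuclideanSpace.single i 1)⟫ = x 0 * D i 0 + x 1 * D i 1 + x 2 * D i 2 :=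
    fun i => inner_eq_three _ _
  simp only [hinner] at hg
  rw [hcurl, inner_eq_three, hn]
  ext i
  fin_cases i
  · simp [cross, cross_apply, hg]
    linear_combination (x 2) * e1 - (x 1) * e2
  · simp [cross, cross_apply, hg]
    linear_combination (x 0) * e2 - (x 2) * e0
  · simp [cross, cross_apply, hg]
    linear_combination (x 1) * e0 - (x 0) * e1

/-- **Part (ii) of `ConeStructure`: the tangential part of `curl U` is a sphere-curl, with the explicit
`0`-homogeneous potential `χ = −⟨x, U(x)⟩`:** `curl U(x) − (⟨x, curl U(x)⟩/‖x‖²) x = ‖x‖⁻² x × ∇χ(x)`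
for `x ≠ 0`. [cite: MajdaBertozziCUP2002, §1.1 (vector identities)] -/
theorem exists_sphereCurl_potential (hU : ContDiffOn ℝ ∞ U {0}ᶜ)
    (hhom : ∀ x : EuclideanSpace ℝ (Fin 3), x ≠ 0 → ∀ c : ℝ, 0 < c → U (c • x) = c⁻¹ • U x) :
    ∃ χ : EuclideanSpace ℝ (Fin 3) → ℝ, ContDiffOn ℝ 1 χ {0}ᶜ ∧
      (∀ x : EuclideanSpace ℝ (Fin 3), x ≠ 0 → ∀ c : ℝ, 0 < c → χ (c • x) = χ x) ∧
      ∀ x : EuclideanSpace ℝ (Fin 3), x ≠ 0 →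
        curl U x - (⟪x, curl U x⟫ / ‖x‖ ^ 2) • x = (‖x‖ ^ 2)⁻¹ • cross x (gradient χ x) := by
  refine ⟨fun y => -⟪y, U y⟫, contDiffOn_chi hU, fun x hx c hc => chi_smul hhom hx hc, fun x hx => ?_⟩
  have hn : ‖x‖ ^ 2 ≠ 0 := pow_ne_zero 2 (norm_ne_zero_iff.2 hx)
  rw [cross_gradient_chi hU hhom hx, smul_sub, smul_smul, inv_mul_cancel₀ hn, one_smul, smul_smul,
    div_eq_inv_mul]

end Summit.NavierStokesRegularity.NavierStokesRegularity.Theorems.ConeStructure
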